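import Mathlib.ModelTheory.Definability
import Mathlib.Analysis.Analytic.Constructions
import Mathlib.Analysis.Analytic.Linear
import Mathlib.Topology.MetricSpace.Pseudo.Pi
import Literature.ModelTheory.ExponentialFields.RealAnExpSubanalytic
import Literature.ModelTheory.ExponentialFields.DefinableHomeomorph
import Literature.Geometry.Manifold.SubanalyticSetsProofs
import HarnessLib

/-!
# Bounded subanalytic sets are definable in every expansion of the real field that defines the
# restricted analytic functions

Proof file (theorems only, no new named facts). `RealAnExpSubanalytic.lean` proves that bounded
semi-analytic and subanalytic subsets of `ℝⁿ` (Hironaka 1975, Def. 3.1 / Def. 3.3: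
`IsSemianalytic`, `IsSubanalytic`) are definable in the particular structure `ℝ_an,exp`
(`Language.realAnExp`). The argument given there uses `exp` nowhere: it only needs that `L` expands
the real field (`IsRealFieldExpansion L`: the graphs of `+` and `·` are definable, hence `<`, the
constants and all polynomial bookkeeping — van den Dries 1998, Ch. 1 (2.3)) and that every restricted
analytic function `[0,1]ⁿ → ℝ` (`RestrictedAnalytic.restrict`, Pila 2022, 8.21) is an `L`-definable
function. This file re-runs the argument VERBATIM at that generality, for an arbitrary first-order
language `L` on `ℝ` together with the two hypotheses

* `hL : IsRealFieldExpansion L`,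
* `hAn : ∀ n (f : RestrictedAnalytic n), (univ : Set ℝ).DefinableFun L f.restrict`,

so that the conclusion applies to `ℝ_an` (the structure generated by the restricted analytic
functions — whose o-minimality is the theorem of Gabrielov 1968 / Denef–van den Dries 1988, a much
smaller input than the o-minimality of `ℝ_an,exp`), to `ℝ_an,exp` (`Language.realAnExp`, where both
hypotheses hold: `realAnExp_isRealFieldExpansion`, `realAnExp_definableFun_restrict` below), and to
any further expansion. Consumer: Buchner's theorem on the cut locus
(`Riemannian/CutLocusBuchnerOMinimalExpansion.lean`), which thereby follows from the o-minimality of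
ANY expansion of the real field defining the restricted analytic functions.

## Main statements (all proved)

* `IsRealFieldExpansion.definable_Icc`, `definable_setOf_comp_mem_Icc` — closed boxes;
  `definable_biUnion_finset_mem` — finite unions (hypothesis only on members of the `Finset`).
* `IsRealFieldExpansion.definable_graphOn_Icc` — under `hAn`, the graph over a closed box
  `Icc a b ⊆ U` (`a < b`) of a function analytic on the open set `U` is `L`-definable
  (affine reparametrisation to the unit cube).
* `IsRealFieldExpansion.exists_boxes_definable_graphOn`, `definable_setOf_mem_and_nonneg`,
  `definable_vectorGraphOn` — as in `RealAnExpSubanalytic.lean`.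
* `Literature.Geometry.Manifold.IsLocallyInBooleanClosure.definable_of_local_traces` —
  globalisation of Hironaka's local Boolean combinations over a compact set, any `L`.
* `IsSemianalytic.definable_of_restrictedAnalytic`, `IsRealFieldExpansion.definable_image_of_isSemianalytic`,
  `IsSubanalytic.definable_of_restrictedAnalytic` (+ `_image`) — **bounded semi-analytic, resp.
  subanalytic, subsets of `ℝⁿ` are `L`-definable under `hL`, `hAn`.**
* `realAnExp_definableFun_restrict` — `ℝ_an,exp` satisfies `hAn` (so the results of
  `RealAnExpSubanalytic.lean` are the special case `L = Language.realAnExp`).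

## References

* [Pila2022] J. Pila, *Point-counting and the Zilber–Pink conjecture*, CUP (2022), 8.21 (globally
  subanalytic sets = the `ℝ_an`-definable sets).
* [Dries1998] L. van den Dries, *Tame topology and o-minimal structures* (1998), Ch. 1 (2.3).
* [VandendriesMiller1994] L. van den Dries, C. Miller, Israel J. Math. 85 (1994), 19–56, Introduction
  (`ℝ_an` and `ℝ_an,exp`).
* [Hironaka1975] H. Hironaka, Triangulations of algebraic sets, PSPM 29 (1975), Def. 3.1, Def. 3.3.
-/

noncomputable section

open Set FirstOrder FirstOrder.Language Filter
open _root_.Topology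

namespace Literature.ModelTheory.ExponentialFields

universe u v

/-! ### Finite unions (any language) -/

/-- Finite unions over a `Finset` of sets each of which is definable (hypothesis only on the
members of the `Finset`). [folklore] -/
theorem definable_biUnion_finset_mem {L : Language.{u, v}} [L.Structure ℝ] {ι β : Type*}
    {s : Finset ι} {t : ι → Set (β → ℝ)} (ht : ∀ i ∈ s, (univ : Set ℝ).Definable L (t i)) :
    (univ : Set ℝ).Definable L (⋃ i ∈ s, t i) := by
  classical
  induction s using Finset.induction_on with
  | empty => simp
  | insert a s ha ih =>
    rw [Finset.set_biUnion_insert]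
    exact (ht a (Finset.mem_insert_self a s)).union
      (ih fun i hi => ht i (Finset.mem_insert_of_mem hi))

/-- `ℝ_an,exp` defines every restricted analytic function (it is a function symbol). [cite: Pila2022, 8.21] -/
theorem realAnExp_definableFun_restrict (n : ℕ) (f : RestrictedAnalytic n) :
    (univ : Set ℝ).DefinableFun Language.realAnExp f.restrict := by
  have hF : (univ : Set ℝ).DefinableFun Language.realAnExp
      (Structure.funMap (L := Language.realAnExp) (M := ℝ) (realAnExpFunc.an f)) :=
    (Set.DefinableFun.fun_symbol (L := Language.realAnExp) (M := ℝ) (realAnExpFunc.an f)).of_empty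
  have heq : (Structure.funMap (L := Language.realAnExp) (M := ℝ) (realAnExpFunc.an f)) =
      f.restrict := funext fun v => Language.realAnExp.funMap_an f v
  rwa [heq] at hF

namespace IsRealFieldExpansion

variable {L : Language.{u, v}} [L.Structure ℝ] (hL : IsRealFieldExpansion L)
include hL

/-! ### Boxes -/

section Boxes

variable {α : Type*} [Fintype α]

/-- Membership of a sub-tuple in a closed box with real corners is a definable condition:
`{v | (fun i => v (τ i)) ∈ Icc a b}`. [folklore] -/
theorem definable_setOf_comp_mem_Icc {γ : Type*} (τ : α → γ) (a b : α → ℝ) :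
    (univ : Set ℝ).Definable L {v : γ → ℝ | (fun i => v (τ i)) ∈ Icc a b} := by
  have key : {v : γ → ℝ | (fun i => v (τ i)) ∈ Icc a b} =
      {v : γ → ℝ | ∀ i : α, a i ≤ v (τ i) ∧ v (τ i) ≤ b i} := by
    ext v
    simp only [mem_setOf_eq, mem_Icc, Pi.le_def]
    exact ⟨fun h i => ⟨h.1 i, h.2 i⟩, fun h => ⟨fun i => (h i).1, fun i => (h i).2⟩⟩
  rw [key]
  exact definable_setOf_forall_index fun i => definable_setOf_and
    (hL.definable_setOf_le (IsRealFieldExpansion.definableFun_const _) (definableFun_proj _))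
    (hL.definable_setOf_le (definableFun_proj _) (IsRealFieldExpansion.definableFun_const _))

/-- Closed boxes with real corners are definable. [folklore] -/
theorem definable_Icc (a b : α → ℝ) :
    (univ : Set ℝ).Definable L (Icc a b : Set (α → ℝ)) := by
  have h := hL.definable_setOf_comp_mem_Icc (id : α → α) a b
  have key : {v : α → ℝ | (fun i => v (id i)) ∈ Icc a b} = Icc a b := by
    ext v
    exact Iff.rfl
  rwa [key] at h

end Boxes

/-! ### Graphs of analytic functions over boxes -/

section Graphs

variable {n : ℕ}

/-- **The graph of an analytic function over a closed box inside its domain of analyticity is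
`L`-definable, provided `L` expands the real field and defines the restricted analytic functions.**
For `a < b` (coordinatewise), `Icc a b ⊆ U`, `U` open and `f` analytic on `U`: after the affine change
of variables `u ↦ a + u (b - a)` of `[0,1]ⁿ` onto `[a,b]`, `f` becomes a restricted analytic function
`g`, and on the box `f(x) = g|_{[0,1]ⁿ}((x - a)/(b - a))` — a definable function of `x` with real
parameters. [cite: Pila2022, 8.21] -/
theorem definable_graphOn_Icc
    (hAn : ∀ (n : ℕ) (f : RestrictedAnalytic n), (univ : Set ℝ).DefinableFun L f.restrict)
    {f : (Fin n → ℝ) → ℝ} {a b : Fin n → ℝ} (hab : ∀ i, a i < b i)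
    {U : Set (Fin n → ℝ)} (hU : IsOpen U) (hsub : Icc a b ⊆ U) (hf : AnalyticOnNhd ℝ f U) :
    (univ : Set ℝ).Definable L
      {v : Fin (n + 1) → ℝ | Fin.init v ∈ Icc a b ∧ v (Fin.last n) = f (Fin.init v)} := by
  -- the affine reparametrisation and its inverse
  set A : (Fin n → ℝ) → (Fin n → ℝ) := fun u i => a i + u i * (b i - a i) with hA
  set B : (Fin n → ℝ) → (Fin n → ℝ) := fun x i => (x i - a i) * (b i - a i)⁻¹ with hB
  have hba : ∀ i, b i - a i ≠ 0 := fun i => (sub_pos.2 (hab i)).ne'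
  have hAB : ∀ x, A (B x) = x := by
    intro x
    funext i
    simp only [hA, hB]
    field_simp [hba i]
    ring
  have hAa : AnalyticOnNhd ℝ A univ := by
    intro u _
    refine (analyticAt_pi_iff (𝕜 := ℝ)).2 fun i => ?_  -- componentwise
    have hproj : AnalyticAt ℝ (fun u : Fin n → ℝ => u i) u :=
      (ContinuousLinearMap.proj i : (Fin n → ℝ) →L[ℝ] ℝ).analyticAt u
    exact analyticAt_const.add (hproj.mul analyticAt_const)
  have hAc : Continuous A := hAa.continuous
  have hAmaps : ∀ u ∈ Icc (0 : Fin n → ℝ) 1, A u ∈ Icc a b := by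
    intro u hu
    rw [mem_Icc] at hu ⊢
    constructor
    · intro i
      have h0 : 0 ≤ u i := hu.1 i
      have : 0 ≤ u i * (b i - a i) := mul_nonneg h0 (sub_pos.2 (hab i)).le
      simp only [hA]
      linarith
    · intro i
      have h1 : u i ≤ 1 := hu.2 i
      have : u i * (b i - a i) ≤ 1 * (b i - a i) :=
        mul_le_mul_of_nonneg_right h1 (sub_pos.2 (hab i)).le
      simp only [hA]
      linarith
  have hBmaps : ∀ x ∈ Icc a b, B x ∈ Icc (0 : Fin n → ℝ) 1 := by
    intro x hx
    rw [mem_Icc] at hx ⊢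
    constructor
    · intro i
      have : 0 ≤ x i - a i := sub_nonneg.2 (hx.1 i)
      exact mul_nonneg this (inv_nonneg.2 (sub_pos.2 (hab i)).le)
    · intro i
      have h1 : x i - a i ≤ b i - a i := sub_le_sub_right (hx.2 i) _
      have hpos : 0 < b i - a i := sub_pos.2 (hab i)
      calc (x i - a i) * (b i - a i)⁻¹ ≤ (b i - a i) * (b i - a i)⁻¹ :=
            mul_le_mul_of_nonneg_right h1 (inv_nonneg.2 hpos.le)
        _ = 1 := mul_inv_cancel₀ hpos.ne'
  -- the restricted analytic function `g = f ∘ A`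
  have hgU : IsOpen (A ⁻¹' U) := hU.preimage hAc
  have hg : AnalyticOnNhd ℝ (f ∘ A) (A ⁻¹' U) := fun u hu => (hf (A u) hu).comp (hAa u (mem_univ u))
  let g : RestrictedAnalytic n :=
    ⟨f ∘ A, A ⁻¹' U, hgU, fun u hu => hsub (hAmaps u hu), hg⟩
  -- definability of `v ↦ g|((init v - a)/(b - a))`
  have hBdef : (univ : Set ℝ).DefinableMap L
      (fun v : Fin (n + 1) → ℝ => B (Fin.init v)) := by
    intro i
    simp only [hB, Fin.init]
    exact hL.definableFun_mul (hL.definableFun_sub (definableFun_proj _) (IsRealFieldExpansion.definableFun_const _))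
      (IsRealFieldExpansion.definableFun_const _)
  have hGdef : (univ : Set ℝ).DefinableFun L
      (fun v : Fin (n + 1) → ℝ => g.restrict (B (Fin.init v))) :=
    (hAn n g).comp hBdef
  -- the definable description of the graph
  have key : {v : Fin (n + 1) → ℝ | Fin.init v ∈ Icc a b ∧ v (Fin.last n) = f (Fin.init v)} =
      {v : Fin (n + 1) → ℝ | (fun i => v (Fin.castSucc i)) ∈ Icc a b ∧
        v (Fin.last n) = g.restrict (B (Fin.init v))} := by
    ext v
    simp only [mem_setOf_eq]
    have hinit : Fin.init v = fun i => v (Fin.castSucc i) := rfl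
    constructor
    · rintro ⟨hv, hval⟩
      refine ⟨hinit ▸ hv, ?_⟩
      rw [hval, g.restrict_of_mem (hBmaps _ hv)]
      show f (Fin.init v) = (f ∘ A) (B (Fin.init v))
      rw [Function.comp_apply, hAB]
    · rintro ⟨hv, hval⟩
      have hv' : Fin.init v ∈ Icc a b := hinit ▸ hv
      refine ⟨hv', ?_⟩
      rw [hval, g.restrict_of_mem (hBmaps _ hv')]
      show (f ∘ A) (B (Fin.init v)) = f (Fin.init v)
      rw [Function.comp_apply, hAB]
  rw [key]
  exact definable_setOf_and (hL.definable_setOf_comp_mem_Icc Fin.castSucc a b)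
    (definable_setOf_eq' (definableFun_proj _) hGdef)

/-- **Finitely many closed boxes around a compact subset of an open set, over which every analytic
function on the open set has a definable graph.** For `C ⊆ U`, `C` compact, `U` open in `ℝⁿ`, there is
a compact `L`-definable `D` (a finite union of closed cubes contained in `U`) with `C ⊆ D ⊆ U` such
that the graph over `D` of every `f` analytic on `U` is `L`-definable (`L` as in
`definable_graphOn_Icc`). [cite: Pila2022, 8.21] -/
theorem exists_boxes_definable_graphOn
    (hAn : ∀ (n : ℕ) (f : RestrictedAnalytic n), (univ : Set ℝ).DefinableFun L f.restrict)
    {U : Set (Fin n → ℝ)} (hU : IsOpen U) {C : Set (Fin n → ℝ)} (hC : IsCompact C) (hCU : C ⊆ U) :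
    ∃ D : Set (Fin n → ℝ), C ⊆ D ∧ D ⊆ U ∧ IsCompact D ∧
      (univ : Set ℝ).Definable L D ∧
      ∀ f : (Fin n → ℝ) → ℝ, AnalyticOnNhd ℝ f U →
        (univ : Set ℝ).Definable L
          {v : Fin (n + 1) → ℝ | Fin.init v ∈ D ∧ v (Fin.last n) = f (Fin.init v)} := by
  classical
  have hr : ∀ x ∈ U, ∃ r : ℝ, 0 < r ∧ Icc (x - fun _ => r) (x + fun _ => r) ⊆ U ∧
      Metric.ball x r ⊆ Icc (x - fun _ => r) (x + fun _ => r) := fun x hx =>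
    Language.realAnExp.exists_Icc_subset_of_isOpen hU hx
  choose! r hr0 hrU hrball using hr
  set box : (Fin n → ℝ) → Set (Fin n → ℝ) := fun x => Icc (x - fun _ => r x) (x + fun _ => r x)
    with hbox
  have hcover : C ⊆ ⋃ x ∈ C, Metric.ball x (r x) := fun x hx =>
    mem_iUnion₂.2 ⟨x, hx, Metric.mem_ball_self (hr0 x (hCU hx))⟩
  obtain ⟨b, hbC, hbfin, hbcover⟩ :=
    hC.elim_finite_subcover_image (fun x _ => Metric.isOpen_ball) hcover
  refine ⟨⋃ x ∈ hbfin.toFinset, box x, ?_, ?_, ?_, ?_, ?_⟩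
  · intro y hy
    obtain ⟨x, hx, hyx⟩ := mem_iUnion₂.1 (hbcover hy)
    exact mem_iUnion₂.2 ⟨x, hbfin.mem_toFinset.2 hx, hrball x (hCU (hbC hx)) hyx⟩
  · intro y hy
    obtain ⟨x, hx, hyx⟩ := mem_iUnion₂.1 hy
    exact hrU x (hCU (hbC (hbfin.mem_toFinset.1 hx))) hyx
  · exact hbfin.toFinset.finite_toSet.isCompact_biUnion fun x _ => isCompact_Icc
  · exact definable_biUnion_finset_mem fun x _ => hL.definable_Icc _ _
  · intro f hf
    have key : {v : Fin (n + 1) → ℝ | Fin.init v ∈ (⋃ x ∈ hbfin.toFinset, box x) ∧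
        v (Fin.last n) = f (Fin.init v)} =
        ⋃ x ∈ hbfin.toFinset, {v : Fin (n + 1) → ℝ | Fin.init v ∈ box x ∧
          v (Fin.last n) = f (Fin.init v)} := by
      ext v
      simp only [mem_setOf_eq, mem_iUnion, exists_prop]
      constructor
      · rintro ⟨⟨x, hx, hv⟩, hval⟩
        exact ⟨x, hx, hv, hval⟩
      · rintro ⟨x, hx, hv, hval⟩
        exact ⟨⟨x, hx, hv⟩, hval⟩
    rw [key]
    refine definable_biUnion_finset_mem fun x hx => ?_
    have hxU : x ∈ U := hCU (hbC (hbfin.mem_toFinset.1 hx))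
    exact hL.definable_graphOn_Icc hAn
      (fun i => by simp only [Pi.sub_apply, Pi.add_apply]; linarith [hr0 x hxU]) hU (hrU x hxU) hf

/-- From a definable graph over `D` to definable superlevel sets over `D`:
`{ξ ∈ D | 0 ≤ g ξ}` is definable. [cite: Dries1998, Ch. 1 (2.3)] -/
theorem definable_setOf_mem_and_nonneg {g : (Fin n → ℝ) → ℝ} {D : Set (Fin n → ℝ)}
    (hG : (univ : Set ℝ).Definable L
      {v : Fin (n + 1) → ℝ | Fin.init v ∈ D ∧ v (Fin.last n) = g (Fin.init v)}) :
    (univ : Set ℝ).Definable L {ξ : Fin n → ℝ | ξ ∈ D ∧ 0 ≤ g ξ} := by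
  have key : {ξ : Fin n → ℝ | ξ ∈ D ∧ 0 ≤ g ξ} = {ξ : Fin n → ℝ | ∃ y : ℝ,
      (Fin.snoc ξ y : Fin (n + 1) → ℝ) ∈
        {v : Fin (n + 1) → ℝ | Fin.init v ∈ D ∧ v (Fin.last n) = g (Fin.init v)} ∧ 0 ≤ y} := by
    ext ξ
    simp only [mem_setOf_eq, Fin.init_snoc, Fin.snoc_last]
    constructor
    · rintro ⟨hξ, hg⟩
      exact ⟨g ξ, ⟨hξ, rfl⟩, hg⟩
    · rintro ⟨y, ⟨hξ, rfl⟩, hy⟩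
      exact ⟨hξ, hy⟩
  rw [key]
  refine definable_setOf_exists (P := fun (ξ : Fin n → ℝ) (y : ℝ) =>
    (Fin.snoc ξ y : Fin (n + 1) → ℝ) ∈
      {v : Fin (n + 1) → ℝ | Fin.init v ∈ D ∧ v (Fin.last n) = g (Fin.init v)} ∧ 0 ≤ y) ?_
  refine definable_setOf_and ?_ (hL.definable_setOf_le (IsRealFieldExpansion.definableFun_const _) (definableFun_proj _))
  exact definable_setOf_snoc_mem' hG Sum.inl (Sum.inr ())

omit hL in
/-- From definable graphs of the components over `D` (and `D` definable) to the definable graph of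
a vector-valued map over `D`, in `Fin n ⊕ Fin k` coordinates:
`{w | w|_inl ∈ D ∧ ∀ j, w (inr j) = h (w|_inl) j}` (any language). [cite: Dries1998, Ch. 1 (2.3)] -/
theorem definable_vectorGraphOn {k : ℕ} {h : (Fin n → ℝ) → (Fin k → ℝ)} {D : Set (Fin n → ℝ)}
    (hD : (univ : Set ℝ).Definable L D)
    (hG : ∀ j : Fin k, (univ : Set ℝ).Definable L
      {v : Fin (n + 1) → ℝ | Fin.init v ∈ D ∧ v (Fin.last n) = h (Fin.init v) j}) :
    (univ : Set ℝ).Definable L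
      {w : Fin n ⊕ Fin k → ℝ | (fun i => w (Sum.inl i)) ∈ D ∧
        ∀ j, w (Sum.inr j) = h (fun i => w (Sum.inl i)) j} := by
  have key : {w : Fin n ⊕ Fin k → ℝ | (fun i => w (Sum.inl i)) ∈ D ∧
      ∀ j, w (Sum.inr j) = h (fun i => w (Sum.inl i)) j} =
      {w : Fin n ⊕ Fin k → ℝ | (w ∘ Sum.inl) ∈ D ∧ ∀ j : Fin k,
        (Fin.snoc (fun i => w (Sum.inl i)) (w (Sum.inr j)) : Fin (n + 1) → ℝ) ∈
          {v : Fin (n + 1) → ℝ | Fin.init v ∈ D ∧ v (Fin.last n) = h (Fin.init v) j}} := by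
    ext w
    simp only [mem_setOf_eq, Fin.init_snoc, Fin.snoc_last]
    constructor
    · rintro ⟨hw, hval⟩
      exact ⟨hw, fun j => ⟨hw, hval j⟩⟩
    · rintro ⟨hw, hval⟩
      exact ⟨hw, fun j => (hval j).2⟩
  rw [key]
  refine definable_setOf_and (definable_setOf_comp_mem hD Sum.inl) ?_
  exact definable_setOf_forall_index fun j => definable_setOf_snoc_mem' (hG j) Sum.inl (Sum.inr j)

end Graphs

end IsRealFieldExpansion

/-! ### Globalisation of Hironaka's local Boolean combinations (any language) -/

section Globalisation

variable {L : Language.{u, v}} [L.Structure ℝ] {n : ℕ}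

open Literature.Geometry.Manifold

/-- **From local Boolean combinations to global definability.** If `A ⊆ K` with `K` compact, `A`
lies locally (at every point, on some open neighbourhood `U`) in the Boolean algebra generated by
admissible generators over `U`, and every point of every open `U` has a definable neighbourhood
`V ⊆ U` on which all admissible generators over `U` have definable trace, then `A` is definable:
the trace of a Boolean combination is the Boolean combination of the traces, and finitely many such
`V` cover `K ⊇ A`. (`RealAnExpSubanalytic.lean` has this for `L = ℝ_an,exp`; the proof is the same
in any language.) [cite: Dries1998, Ch. 1 (2.3)] -/
theorem _root_.Literature.Geometry.Manifold.IsLocallyInBooleanClosure.definable_of_local_traces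
    {gen : Set (Fin n → ℝ) → Set (Set (Fin n → ℝ))} {A K : Set (Fin n → ℝ)}
    (hA : IsLocallyInBooleanClosure gen A) (hK : IsCompact K) (hAK : A ⊆ K)
    (hloc : ∀ (x : Fin n → ℝ) (U : Set (Fin n → ℝ)), IsOpen U → x ∈ U →
      ∃ V ∈ 𝓝 x, V ⊆ U ∧ (univ : Set ℝ).Definable L V ∧
        ∀ s ∈ gen U, (univ : Set ℝ).Definable L (s ∩ V)) :
    (univ : Set ℝ).Definable L A := by
  classical
  -- at every point, a neighbourhood on which `A` has definable trace
  have hpt : ∀ x : Fin n → ℝ, ∃ V ∈ 𝓝 x, (univ : Set ℝ).Definable L (A ∩ V) := by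
    intro x
    obtain ⟨U, hUo, hxU, S, _, hSg, B, hB, hAB⟩ := hA x
    obtain ⟨V, hV, hVU, hVdef, hgenV⟩ := hloc x U hUo hxU
    have hBV' : ∀ B' : Set (Fin n → ℝ), B' ∈ BooleanSubalgebra.closure S →
        (univ : Set ℝ).Definable L (B' ∩ V) := by
      intro B' hB'
      induction hB' using BooleanSubalgebra.closure_bot_sup_induction with
      | mem s hs => exact hgenV s (hSg hs)
      | bot => simp
      | sup s _ t _ hs ht =>
        have h := hs.union ht
        rwa [← union_inter_distrib_right] at h
      | compl s _ hs =>
        have h := hVdef.sdiff hs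
        have heq : V \ (s ∩ V) = sᶜ ∩ V := by
          ext ξ
          simp only [Set.mem_sdiff, mem_inter_iff, mem_compl_iff]
          tauto
        rwa [heq] at h
    have hBV : (univ : Set ℝ).Definable L (B ∩ V) := hBV' B hB
    refine ⟨V, hV, ?_⟩
    have hAV : A ∩ V = B ∩ V := by
      have h1 : A ∩ V = (A ∩ U) ∩ V := by
        rw [inter_assoc, inter_eq_right.2 hVU]
      rw [h1, hAB, inter_assoc, inter_eq_right.2 hVU]
    rw [hAV]
    exact hBV
  choose V hV hVdef using hpt
  -- finitely many of them cover `K`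
  have hcover : K ⊆ ⋃ x ∈ K, interior (V x) := fun x hx =>
    mem_iUnion₂.2 ⟨x, hx, mem_interior_iff_mem_nhds.2 (hV x)⟩
  obtain ⟨b, -, hbfin, hbcover⟩ :=
    hK.elim_finite_subcover_image (fun x _ => isOpen_interior) hcover
  have hAeq : A = ⋃ x ∈ hbfin.toFinset, (A ∩ V x) := by
    apply Subset.antisymm
    · intro a ha
      obtain ⟨x, hx, hax⟩ := mem_iUnion₂.1 (hbcover (hAK ha))
      exact mem_iUnion₂.2 ⟨x, hbfin.mem_toFinset.2 hx, ha, interior_subset hax⟩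
    · exact iUnion₂_subset fun x _ => inter_subset_left
  rw [hAeq]
  exact definable_biUnion_finset_mem fun x _ => hVdef x

end Globalisation

/-! ### Bounded semi-analytic and subanalytic sets are definable -/

section Subanalytic

variable {L : Language.{u, v}} [L.Structure ℝ] {n : ℕ}

open Literature.Geometry.Manifold

/-- **Bounded semi-analytic subsets of `ℝⁿ` are definable in every expansion of the real field that
defines the restricted analytic functions** (they are globally subanalytic, Pila 2022, 8.21): near
every point, on a small closed cube inside the neighbourhood of Hironaka's Def. 3.1, each generator
`{f ≥ 0}` has definable trace (`f` is restricted analytic on the cube), and the cube traces globalise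
over the compact closure. [cite: Pila2022, 8.21] -/
theorem _root_.Literature.Geometry.Manifold.IsSemianalytic.definable_of_restrictedAnalytic
    (hL : IsRealFieldExpansion L)
    (hAn : ∀ (n : ℕ) (f : RestrictedAnalytic n), (univ : Set ℝ).DefinableFun L f.restrict)
    {A : Set (Fin n → ℝ)} (hA : IsSemianalytic A) (hb : Bornology.IsBounded A) :
    (univ : Set ℝ).Definable L A := by
  refine hA.definable_of_local_traces hb.isCompact_closure subset_closure fun x U hUo hxU => ?_
  obtain ⟨r, hr0, hrU, hball⟩ := Language.realAnExp.exists_Icc_subset_of_isOpen hUo hxU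
  refine ⟨Icc (x - fun _ => r) (x + fun _ => r), mem_of_superset (Metric.ball_mem_nhds x hr0) hball,
    hrU, hL.definable_Icc _ _, ?_⟩
  rintro s ⟨f, hf, rfl⟩
  have hG := hL.definable_graphOn_Icc hAn
    (fun i => by simp only [Pi.sub_apply, Pi.add_apply]; linarith) hUo hrU hf
  have h := hL.definable_setOf_mem_and_nonneg hG
  have heq : {ξ : Fin n → ℝ | 0 ≤ f ξ} ∩ Icc (x - fun _ => r) (x + fun _ => r) =
      {ξ : Fin n → ℝ | ξ ∈ Icc (x - fun _ => r) (x + fun _ => r) ∧ 0 ≤ f ξ} := by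
    ext ξ
    simp only [mem_inter_iff, mem_setOf_eq]
    tauto
  rw [heq]
  exact h

/-- **Images of bounded semi-analytic sets under entire analytic maps are definable** (Hironaka's
generators of Def. 3.3), in every expansion of the real field defining the restricted analytic
functions: `f(B) = {y | ∃ u ∈ B, y = f u}` with `B` definable and the graph of `f` over a cube
containing `B` definable. [cite: Pila2022, 8.21] -/
theorem IsRealFieldExpansion.definable_image_of_isSemianalytic (hL : IsRealFieldExpansion L)
    (hAn : ∀ (n : ℕ) (f : RestrictedAnalytic n), (univ : Set ℝ).DefinableFun L f.restrict)
    {m : ℕ} {B : Set (Fin m → ℝ)} (hB : IsSemianalytic B)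
    (hBb : Bornology.IsBounded B) {f : (Fin m → ℝ) → (Fin n → ℝ)} (hf : AnalyticOnNhd ℝ f univ) :
    (univ : Set ℝ).Definable L (f '' B) := by
  have hBdef := hB.definable_of_restrictedAnalytic hL hAn hBb
  -- a cube containing `B`
  obtain ⟨R, hR⟩ := hBb.subset_closedBall 0
  set Q : Set (Fin m → ℝ) := Icc (fun _ => -(|R| + 1)) (fun _ => |R| + 1) with hQ
  have hBQ : B ⊆ Q := by
    intro u hu
    have hu' := hR hu
    rw [Metric.mem_closedBall] at hu'
    have hR0 : 0 ≤ R := dist_nonneg.trans hu'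
    rw [dist_pi_le_iff hR0] at hu'
    rw [hQ, mem_Icc]
    constructor
    · intro i
      have h := hu' i
      simp only [Pi.zero_apply, Real.dist_0_eq_abs, abs_le] at h
      dsimp only
      linarith [h.1, le_abs_self R]
    · intro i
      have h := hu' i
      simp only [Pi.zero_apply, Real.dist_0_eq_abs, abs_le] at h
      dsimp only
      linarith [h.2, le_abs_self R]
  -- graphs of the components over `Q`
  have hGj : ∀ j : Fin n, (univ : Set ℝ).Definable L
      {v : Fin (m + 1) → ℝ | Fin.init v ∈ Q ∧ v (Fin.last m) = f (Fin.init v) j} := by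
    intro j
    have hfj : AnalyticOnNhd ℝ (fun u => f u j) univ := fun u hu =>
      ((ContinuousLinearMap.proj j : (Fin n → ℝ) →L[ℝ] ℝ).analyticAt (f u)).comp (hf u hu)
    have hpos : (0 : ℝ) < |R| + 1 := by positivity
    exact hL.definable_graphOn_Icc hAn (f := fun u => f u j)
      (fun i => by linarith) isOpen_univ (subset_univ _) hfj
  have hQdef : (univ : Set ℝ).Definable L Q := by
    rw [hQ]
    exact hL.definable_Icc _ _
  have hV := IsRealFieldExpansion.definable_vectorGraphOn hQdef hGj
  -- `f '' B` as a projection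
  have key : f '' B = {y : Fin n → ℝ | ∃ u : Fin m → ℝ, u ∈ B ∧
      (Sum.elim u y : Fin m ⊕ Fin n → ℝ) ∈ {w : Fin m ⊕ Fin n → ℝ | (fun i => w (Sum.inl i)) ∈ Q ∧
        ∀ j, w (Sum.inr j) = f (fun i => w (Sum.inl i)) j}} := by
    ext y
    simp only [mem_image, mem_setOf_eq, Sum.elim_inl, Sum.elim_inr]
    constructor
    · rintro ⟨u, hu, rfl⟩
      exact ⟨u, hu, hBQ hu, fun j => rfl⟩
    · rintro ⟨u, hu, -, hval⟩
      exact ⟨u, hu, (funext hval).symm⟩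
  rw [key]
  refine definable_setOf_exists_fin (P := fun (y : Fin n → ℝ) (u : Fin m → ℝ) => u ∈ B ∧
    (Sum.elim u y : Fin m ⊕ Fin n → ℝ) ∈ {w : Fin m ⊕ Fin n → ℝ | (fun i => w (Sum.inl i)) ∈ Q ∧
      ∀ j, w (Sum.inr j) = f (fun i => w (Sum.inl i)) j}) ?_
  refine definable_setOf_and (definable_setOf_comp_mem hBdef Sum.inr) ?_
  have h := hV.preimage_comp (Sum.swap : Fin m ⊕ Fin n → Fin n ⊕ Fin m)
  convert h using 1
  ext w
  simp only [mem_setOf_eq, mem_preimage, Function.comp_apply, Sum.swap_inl, Sum.swap_inr,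
    Sum.elim_inl, Sum.elim_inr]

/-- **Bounded subanalytic subsets of `ℝⁿ` are definable in every expansion of the real field that
defines the restricted analytic functions** (globally subanalytic sets are `ℝ_an`-definable, Pila
2022, 8.21 — the elementary direction): Hironaka's generators `f(B)` (Def. 3.3) are definable outright
(`IsRealFieldExpansion.definable_image_of_isSemianalytic`), and the local Boolean combinations
globalise over the compact closure. [cite: Pila2022, 8.21] -/
theorem _root_.Literature.Geometry.Manifold.IsSubanalytic.definable_of_restrictedAnalytic
    (hL : IsRealFieldExpansion L)
    (hAn : ∀ (n : ℕ) (f : RestrictedAnalytic n), (univ : Set ℝ).DefinableFun L f.restrict)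
    {A : Set (Fin n → ℝ)} (hA : IsSubanalytic A) (hb : Bornology.IsBounded A) :
    (univ : Set ℝ).Definable L A := by
  refine hA.definable_of_local_traces hb.isCompact_closure subset_closure fun x U hUo hxU => ?_
  obtain ⟨r, hr0, hrU, hball⟩ := Language.realAnExp.exists_Icc_subset_of_isOpen hUo hxU
  refine ⟨Icc (x - fun _ => r) (x + fun _ => r), mem_of_superset (Metric.ball_mem_nhds x hr0) hball,
    hrU, hL.definable_Icc _ _, ?_⟩
  rintro s ⟨m, B, f, hB, hBb, hf, rfl⟩
  exact (hL.definable_image_of_isSemianalytic hAn hB hBb hf).inter (hL.definable_Icc _ _)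

/-- The same for a bounded subanalytic subset of any finite-dimensional real normed space `E`, read
in coordinates through a linear isomorphism `e : E ≃ ℝⁿ` (subanalyticity and boundedness are
transported by `e`). [cite: Pila2022, 8.21] -/
theorem _root_.Literature.Geometry.Manifold.IsSubanalytic.definable_image_of_restrictedAnalytic
    (hL : IsRealFieldExpansion L)
    (hAn : ∀ (n : ℕ) (f : RestrictedAnalytic n), (univ : Set ℝ).DefinableFun L f.restrict)
    {E : Type*} [NormedAddCommGroup E] [NormedSpace ℝ E] {A : Set E}
    (hA : IsSubanalytic A) (hb : Bornology.IsBounded A) (e : E ≃L[ℝ] (Fin n → ℝ)) :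
    (univ : Set ℝ).Definable L (e '' A) := by
  refine (hA.image_equiv e).definable_of_restrictedAnalytic hL hAn ?_
  exact e.lipschitz.isBounded_image hb

end Subanalytic

end Literature.ModelTheory.ExponentialFields
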